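import Summits.QuantumFields.BalabanUV.T4Continuum.Support.NE7MinimalOrbitDatumContinuity
import HarnessLib

/-!
# NE7MinimalActionContinuousOn — THE MINIMAL ACTION `V ↦ A_k(V)` IS A CONTINUOUS FUNCTION ON THE SMALL DATA (Mathlib's `ContinuousOn`, product topology): for every
# `U(n)`, every `L ≥ 2`, `d = 4`, `0 < ε ≤ ε₀`, `N ≥ 1`, at every level `k`, the honest infimum `MinimalActionSandwich.minAct 4 (sfClass 4 L N ε) L N k` (print's `A_k(V)`,
# [Balaban1985Variational] (5)–(6)) restricted to the small data class `{V unitary, N-periodic, SmallField V δ_V}` is `ContinuousOn` — gen 113's filter statement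
# `NE7MinimalOrbitDatumContinuity.minAct_continuous` repackaged as a standard predicate for consumers

Cell `pub-balaban`, rung (B)+1 sub-cell t4, lineage `b2b-balaban-t4-ne7-p1` (CRUX PROVER NE7 #1 = OWNER of BINDER row NE7), generation 113.  Memo
`t4/b2b-balaban-t4-ne7-p1-g113/ROAD-G113.md` §5.  Over ✓ p819290 `NE7MinimalOrbitDatumContinuity.minAct_continuous` and [tree] `MinimalActionSandwich.IsMinimiser.minAct_eq`
(a minimiser realises the infimum).
WHAT ([folklore]; 0 def, 0 sorry).  **`continuousOn_minAct`**: `∃ ε₀ > 0, ∀ 0 < ε ≤ ε₀, ∀ N ≥ 1, ∃ δ_V > 0, ∀ k, ContinuousOn (fun V ↦ minAct 4 (sfClass 4 L N ε) L N k V)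
{V | IsUnitaryCfg V ∧ IsPeriodicCfg V N ∧ SmallField V δ_V}`.
HONEST FRAMING (page 1): soft repackaging of a landed kernel theorem; nothing of Bałaban's asserted as an axiom; finite 4-torus, small data, thresholds existential; NOT NE7 as a spine
node (dagwriter∕referees' call), NOT NE3; spine 0∕9; NOT infinite volume, NOT mass gap, NOT BetaPertH, NOT Clay (continuum YM on T⁴ ⇐ BetaPertH ∧ nine spine estimates).
-/

set_option autoImplicit false

open scoped BigOperators Matrix Matrix.Norms.L2Operator Topology
open NormedSpace Finset Set Filter

namespace Summit.QuantumFields.BalabanUV.T4Continuum.NE7MinimalActionContinuousOn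

open Literature.MathematicalPhysics.QuantumFieldTheory.Balaban1983to89
open B7Prop1Explicit B7Prop2Explicit
open T4AveragingDeficitWall (IsUnitaryCfg SmallField)
open T4AveragingDeficitWallBoundary (IsPeriodicCfg)
open MinimalActionLevels (levelAction)
open MinimalActionSandwich (IsMinimiser admissible minAct)
open MinimalActionRate (sfClass)
open NE7MinimalOrbitDatumContinuity (minAct_continuous)

noncomputable section

variable {n : Type} [Fintype n] [DecidableEq n]

/-- **THE MINIMAL ACTION IS CONTINUOUS ON THE SMALL DATA, EVERY `U(n)`, EVERY `L ≥ 2`, `d = 4`** (statement in the file header). [folklore] -/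
theorem continuousOn_minAct [Nonempty n] {L : ℕ} (hL : 2 ≤ L) :
    ∃ ε₀ : ℝ, 0 < ε₀ ∧ ∀ ε : ℝ, 0 < ε → ε ≤ ε₀ → ∀ (N : ℕ) [NeZero N], 1 ≤ N →
      ∃ δV : ℝ, 0 < δV ∧ ∀ k : ℕ,
        ContinuousOn (fun V : Site 4 → Fin 4 → (Matrix n n ℂ)ˣ => minAct 4 (sfClass 4 L N ε) L N k V)
          {V : Site 4 → Fin 4 → (Matrix n n ℂ)ˣ | IsUnitaryCfg V ∧ IsPeriodicCfg V (N : ℤ) ∧ SmallField V δV} := by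
  obtain ⟨ε₀, hε₀, H⟩ := minAct_continuous (n := n) hL
  refine ⟨ε₀, hε₀, fun ε hε hεle N _ hN => ?_⟩
  obtain ⟨δV, hδV, K⟩ := H ε hε hεle N hN
  refine ⟨δV, hδV, fun k V₀ hV₀ => ?_⟩
  obtain ⟨Us, hUs, hcont⟩ := K V₀ hV₀ k
  rw [ContinuousWithinAt, Metric.tendsto_nhds]
  intro η hη
  have hev := hcont η hη
  have hmem : ∀ᶠ V in 𝓝[{V : Site 4 → Fin 4 → (Matrix n n ℂ)ˣ | IsUnitaryCfg V ∧ IsPeriodicCfg V (N : ℤ) ∧ SmallField V δV}] V₀,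
      V ∈ {V : Site 4 → Fin 4 → (Matrix n n ℂ)ˣ | IsUnitaryCfg V ∧ IsPeriodicCfg V (N : ℤ) ∧ SmallField V δV} := eventually_mem_nhdsWithin
  filter_upwards [eventually_nhdsWithin_of_eventually_nhds hev, hmem] with V hV hVS
  obtain ⟨⟨U, hU⟩, hall⟩ := hV hVS.1 hVS.2.1
  rw [hU.minAct_eq, hUs.minAct_eq, Real.dist_eq]
  exact hall U hU

end

end Summit.QuantumFields.BalabanUV.T4Continuum.NE7MinimalActionContinuousOn
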